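import Literature.MathematicalPhysics.QuantumLattice.ApproximatingHamiltonianProofs
import Literature.MathematicalPhysics.QuantumLattice.DuhamelTwoPointProofs
import Literature.MathematicalPhysics.QuantumLattice.HubbardTorusFluxThermalBlochBound
import Literature.MathematicalPhysics.QuantumLattice.EnergyEntropyBalance
import Mathlib
import HarnessLib

/-!
# The current formula `d/dθ log Z(H + W(θ)) = −β Re⟨W′(θ)⟩` and its mean-value packaging

Helper module for route `TcThermcert1`, cruxes K1′ `ThermalStiffnessCeilingU8b8_le_7o44` (item `stmt-Ventures-24560`)
and K1 `ThermalStiffnessCeilingU8b10_le_1o8` (item `stmt-Ventures-26381`), line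
`Cruxes/ThermalStiffnessCeilingU8b10_le_1o8/Lines/gauge_qbp_far_seam.lean`, stub A (`stub_twistCost_of_farCutCurrent`:
"twist cost of the sector free energy = `β ×` the flux-integrated persistent current"). This file is the MODEL-FREE
calculus of that stub; the model-specific inputs (the seam family `θ ↦ seamTwist L θ`, its sector blocks, the
stationarity identity relocating the current to a far cut) are not touched here.

* §1 `hasDerivAt_log_partitionFn_add_smul`: for a Hermitian `H` on a nonempty index type, any `Y` and real `β`,
  `t ↦ log Re tr e^{−β(H + tY)}` has derivative `−β Re⟨Y⟩_{β,H}` at `t = 0` (the tree's Duhamel/cyclicity lemma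
  `Matrix.hasDerivAt_re_trace_exp_add_smul` and `Re Z > 0`).
* §2 `hasDerivAt_log_partitionFn_of_hasDerivAt`: the same along a differentiable Hermitian family `t ↦ H + W t` with
  `HasDerivAt W W′ t₀`: derivative `−β Re⟨W′⟩_{β,H + W t₀}` (the linearisation error is `o(t − t₀)` because
  `H ↦ log Re Z_β(H)` is `β`-Lipschitz, `abs_log_partitionFn_sub_log_partitionFn_le`).
* §3 `abs_log_partitionFn_sub_le_of_gibbsState_bound`: mean-value packaging — if `|Re⟨W′ t⟩_{H + W t}| ≤ η` for
  `|t| ≤ θ₁` then `|log Re Z(H + W 0) − log Re Z(H + W θ)| ≤ β η |θ|` for every `|θ| ≤ θ₁`.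
* §4 `gibbsState_map_starRingEnd`, `re_gibbsState_eq_zero_of_map_starRingEnd`: time reversal — in a Hamiltonian with
  real (conjugation-invariant) matrix the expectation of a conjugation-odd observable has zero real part (a persistent
  current at zero flux vanishes).
* §5 `hasDerivAt_toBlock`, `hasDerivAt_sum_smul`: calculus plumbing (blocks of a differentiable matrix family; finite
  sums `Σ c_i(t) • M_i`), so that the seam family's sector blocks can be fed to §2–§3 without norm-instance detours.
* §6 `toBlock_mul_of_offDiag_right/left`, `gibbsState_toBlock_commutator_eq_zero`: block multiplicativity against a
  sector-preserving operator and the sector form of stationarity `⟨[H, N]|_p⟩_{β,H|_p} = 0` (tree: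
  `gibbsState_commutator_eq_zero`).

All statements are finite-dimensional folklore (Bratteli–Robinson II §5.3; Dyson–Lieb–Simon 1978 §3 for the Duhamel
derivative). Nothing about superconductivity in the Hubbard model is proved by anything in this file.
-/

noncomputable section

open scoped Matrix.Norms.L2Operator ComplexOrder ComplexConjugate
open Filter Topology NormedSpace Asymptotics Matrix
open Literature.MathematicalPhysics.QuantumLattice

namespace Summit.Ventures.CertifiedManyBodySolver.Theorems.TcThermcert1.GaugeQbpFarSeam

variable {m : Type*} [Fintype m] [DecidableEq m]

/-! ## §1 Linear families: `d/dt|₀ log Re Z(H + tY) = −β Re⟨Y⟩_H` -/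

omit [Fintype m] [DecidableEq m] in
/-- Real scalars act on complex matrices through the coercion `ℝ → ℂ`. [folklore] -/
theorem real_smul_eq_coe_smul (r : ℝ) (M : Matrix m m ℂ) : r • M = (r : ℂ) • M :=
  (Complex.coe_smul r M).symm

omit [Fintype m] [DecidableEq m] in
/-- A real multiple of a Hermitian matrix is Hermitian. [folklore] -/
theorem isHermitian_real_smul {M : Matrix m m ℂ} (hM : M.IsHermitian) (r : ℝ) :
    (r • M).IsHermitian := by
  rw [real_smul_eq_coe_smul]
  unfold Matrix.IsHermitian
  rw [conjTranspose_smul, hM.eq, Complex.star_def, Complex.conj_ofReal]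

/-- `−β(H + tY) = −βH + t(−βY)`: the Gibbs exponent of a linear family is a linear family. [folklore] -/
theorem partitionFn_add_smul_eq (β : ℝ) (H Y : Matrix m m ℂ) (t : ℝ) :
    partitionFn β (H + t • Y) = (exp (-(β : ℂ) • H + t • (-(β : ℂ) • Y))).trace := by
  rw [partitionFn, gibbsWeight, smul_add, smul_comm (-(β : ℂ)) t Y]

/-- **Current formula, linear family**: for Hermitian `H` (nonempty index type), any matrix `Y` and real `β`,
`d/dt|_{t=0} log Re tr e^{−β(H + tY)} = −β · Re⟨Y⟩_{β,H}`, where `⟨Y⟩_{β,H} = tr(e^{−βH} Y)/Z`.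
(Duhamel's formula with the cyclicity of the trace, `Matrix.hasDerivAt_re_trace_exp_add_smul`, then the
logarithmic derivative using `Re Z > 0`.) [cite: DLS1978, §3] -/
theorem hasDerivAt_log_partitionFn_add_smul [Nonempty m] {H : Matrix m m ℂ} (hH : H.IsHermitian)
    (Y : Matrix m m ℂ) (β : ℝ) :
    HasDerivAt (fun t : ℝ => Real.log (partitionFn β (H + t • Y)).re)
      (-(β * (gibbsState β H Y).re)) 0 := by
  have hd : HasDerivAt (fun t : ℝ => (partitionFn β (H + t • Y)).re)
      ((-(β : ℂ) • Y * exp (-(β : ℂ) • H + (0 : ℝ) • (-(β : ℂ) • Y))).trace.re) 0 := by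
    refine (hasDerivAt_re_trace_exp_add_smul (-(β : ℂ) • H) (-(β : ℂ) • Y) 0).congr_of_eventuallyEq
      (Eventually.of_forall fun t => ?_)
    simp only [partitionFn_add_smul_eq]
  simp only [zero_smul, add_zero] at hd
  have hpos : 0 < (partitionFn β H).re := partitionFn_re_pos hH β
  have hlog := hd.log (by simp only [zero_smul, add_zero]; exact hpos.ne')
  refine hlog.congr_deriv ?_
  simp only [zero_smul, add_zero]
  rw [Matrix.smul_mul, trace_smul, smul_eq_mul, trace_mul_comm, gibbsState_apply,
    show exp (-(β : ℂ) • H) = gibbsWeight β H from rfl]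
  set T : ℂ := (gibbsWeight β H * Y).trace
  rw [partitionFn_eq_re hH β, Complex.ofReal_re, ← Complex.ofReal_inv, Complex.re_ofReal_mul,
    ← Complex.ofReal_neg, Complex.re_ofReal_mul]
  field_simp

/-! ## §2 Differentiable Hermitian families -/

/-- **Current formula, general family**: if `t ↦ W t` is a family of Hermitian matrices with `HasDerivAt W W′ t₀`,
`W′` Hermitian, `H` Hermitian, `0 ≤ β`, then `t ↦ log Re tr e^{−β(H + W t)}` has derivative
`−β · Re⟨W′⟩_{β, H + W t₀}` at `t₀`. (Linearise `W` at `t₀`; the error is `o(t − t₀)` in norm, and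
`H ↦ log Re Z_β(H)` is `β`-Lipschitz by `abs_log_partitionFn_sub_log_partitionFn_le`.) [folklore] -/
theorem hasDerivAt_log_partitionFn_of_hasDerivAt [Nonempty m] {H W' : Matrix m m ℂ}
    {W : ℝ → Matrix m m ℂ} (hH : H.IsHermitian) (hW : ∀ t, (W t).IsHermitian)
    (hW' : W'.IsHermitian) {t₀ : ℝ} (hd : HasDerivAt W W' t₀) {β : ℝ} (hβ : 0 ≤ β) :
    HasDerivAt (fun t : ℝ => Real.log (partitionFn β (H + W t)).re)
      (-(β * (gibbsState β (H + W t₀) W').re)) t₀ := by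
  set F : ℝ → ℝ := fun t => Real.log (partitionFn β (H + W t)).re with hF
  set G : ℝ → ℝ := fun t => Real.log (partitionFn β (H + W t₀ + (t - t₀) • W')).re with hG
  have hH₁ : (H + W t₀).IsHermitian := hH.add (hW t₀)
  -- the linearised family has the claimed derivative (§1, shifted to `t₀`)
  have hGd : HasDerivAt G (-(β * (gibbsState β (H + W t₀) W').re)) t₀ := by
    have h := hasDerivAt_log_partitionFn_add_smul hH₁ W' β
    rw [← sub_self t₀] at h
    exact HasDerivAt.comp_sub_const t₀ t₀ h
  -- the difference `F − G` is `o(t − t₀)`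
  have hFG0 : F t₀ = G t₀ := by
    simp only [hF, hG, sub_self, zero_smul, add_zero]
  have hFG : HasDerivAt (fun t => F t - G t) 0 t₀ := by
    rw [hasDerivAt_iff_isLittleO]
    refine IsBigO.trans_isLittleO ?_ (hasDerivAt_iff_isLittleO.mp hd)
    refine IsBigO.of_bound β (Eventually.of_forall fun t => ?_)
    have hlin : (H + W t₀ + (t - t₀) • W').IsHermitian := hH₁.add (isHermitian_real_smul hW' _)
    have key := abs_log_partitionFn_sub_log_partitionFn_le (hH.add (hW t)) hlin hβ
    have hdiff : H + W t - (H + W t₀ + (t - t₀) • W') = W t - W t₀ - (t - t₀) • W' := by abel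
    rw [hdiff] at key
    have hval : F t - G t - (F t₀ - G t₀) - (t - t₀) • (0 : ℝ) = F t - G t := by
      rw [hFG0, sub_self, sub_zero, smul_zero, sub_zero]
    rw [hval, Real.norm_eq_abs]
    exact key
  have hsum := hGd.add hFG
  rw [add_zero] at hsum
  refine hsum.congr_of_eventuallyEq (Eventually.of_forall fun t => ?_)
  show F t = G t + (F t - G t)
  ring

/-! ## §3 Mean-value packaging -/

/-- **Twist cost from a current bound**: along an everywhere-differentiable Hermitian family `t ↦ H + W t`
(`HasDerivAt W (W′ t) t`, all `W t`, `W′ t`, `H` Hermitian, `0 ≤ β`), a bound `|Re⟨W′ t⟩_{β,H + W t}| ≤ η` on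
`|t| ≤ θ₁` gives `|log Re Z(H + W 0) − log Re Z(H + W θ)| ≤ β η |θ|` for `|θ| ≤ θ₁` (mean value inequality
on `[−θ₁, θ₁]` with §2). [folklore] -/
theorem abs_log_partitionFn_sub_le_of_gibbsState_bound [Nonempty m] {H : Matrix m m ℂ}
    {W W' : ℝ → Matrix m m ℂ} (hH : H.IsHermitian) (hW : ∀ t, (W t).IsHermitian)
    (hW' : ∀ t, (W' t).IsHermitian) (hd : ∀ t, HasDerivAt W (W' t) t) {β : ℝ} (hβ : 0 ≤ β)
    {θ₁ η : ℝ} (hη : ∀ t : ℝ, |t| ≤ θ₁ → |(gibbsState β (H + W t) (W' t)).re| ≤ η)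
    {θ : ℝ} (hθ : |θ| ≤ θ₁) :
    |Real.log (partitionFn β (H + W 0)).re - Real.log (partitionFn β (H + W θ)).re| ≤ β * η * |θ| := by
  have hθ₁ : 0 ≤ θ₁ := (abs_nonneg θ).trans hθ
  have hderiv : ∀ t ∈ Set.Icc (-θ₁) θ₁,
      HasDerivWithinAt (fun t : ℝ => Real.log (partitionFn β (H + W t)).re)
        ((fun t : ℝ => -(β * (gibbsState β (H + W t) (W' t)).re)) t) (Set.Icc (-θ₁) θ₁) t :=
    fun t _ => (hasDerivAt_log_partitionFn_of_hasDerivAt hH hW (hW' t) (hd t) hβ).hasDerivWithinAt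
  have hbound : ∀ t ∈ Set.Icc (-θ₁) θ₁,
      ‖(fun t : ℝ => -(β * (gibbsState β (H + W t) (W' t)).re)) t‖ ≤ β * η := by
    intro t ht
    rw [norm_neg, Real.norm_eq_abs, abs_mul, abs_of_nonneg hβ]
    exact mul_le_mul_of_nonneg_left (hη t (abs_le.mpr ⟨ht.1, ht.2⟩)) hβ
  have h := (convex_Icc (-θ₁) θ₁).norm_image_sub_le_of_norm_hasDerivWithin_le hderiv hbound
    (Set.mem_Icc.mpr ⟨neg_nonpos.mpr hθ₁, hθ₁⟩) (Set.mem_Icc.mpr (abs_le.mp hθ))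
  rw [sub_zero, Real.norm_eq_abs, Real.norm_eq_abs] at h
  rwa [abs_sub_comm]

/-- The special case used by the line: a current bound `|Re⟨W′ t⟩| ≤ η` on `|t| ≤ θ₁` makes the twist cost at most
`β η θ₁` uniformly on `|θ| ≤ θ₁`. [folklore] -/
theorem abs_log_partitionFn_sub_le_of_gibbsState_bound' [Nonempty m] {H : Matrix m m ℂ}
    {W W' : ℝ → Matrix m m ℂ} (hH : H.IsHermitian) (hW : ∀ t, (W t).IsHermitian)
    (hW' : ∀ t, (W' t).IsHermitian) (hd : ∀ t, HasDerivAt W (W' t) t) {β : ℝ} (hβ : 0 ≤ β)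
    {θ₁ η : ℝ} (hη : ∀ t : ℝ, |t| ≤ θ₁ → |(gibbsState β (H + W t) (W' t)).re| ≤ η)
    {θ : ℝ} (hθ : |θ| ≤ θ₁) :
    |Real.log (partitionFn β (H + W 0)).re - Real.log (partitionFn β (H + W θ)).re| ≤ β * η * θ₁ := by
  have h := abs_log_partitionFn_sub_le_of_gibbsState_bound hH hW hW' hd hβ hη hθ
  have hη0 : 0 ≤ η := (abs_nonneg _).trans (hη θ hθ)
  exact h.trans (mul_le_mul_of_nonneg_left hθ (mul_nonneg hβ hη0))

/-! ## §4 Time reversal -/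

/-- **Time reversal of Gibbs expectations**: `⟨conj A⟩_{β, conj M} = conj ⟨A⟩_{β, M}` for entrywise complex
conjugation (`gibbsWeight_map_starRingEnd`, `partitionFn_map_starRingEnd`). [folklore] -/
theorem gibbsState_map_starRingEnd (β : ℝ) (M A : Matrix m m ℂ) :
    gibbsState β (M.map (starRingEnd ℂ)) (A.map (starRingEnd ℂ)) = starRingEnd ℂ (gibbsState β M A) := by
  rw [gibbsState_apply, gibbsState_apply, partitionFn_map_starRingEnd, gibbsWeight_map_starRingEnd,
    ← Matrix.map_mul, map_mul, map_inv₀]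
  congr 1
  simp only [Matrix.trace, Matrix.diag_apply, Matrix.map_apply, map_sum]

/-- If the Hamiltonian matrix is conjugation-invariant (`M.map conj = M`, e.g. a Hubbard matrix with real hoppings
in the occupation basis) and the observable is conjugation-odd (`A.map conj = −A`, e.g. a current `−i(c†c − h.c.)`),
then `Re⟨A⟩_{β,M} = 0`. [folklore] -/
theorem re_gibbsState_eq_zero_of_map_starRingEnd (β : ℝ) {M A : Matrix m m ℂ}
    (hM : M.map (starRingEnd ℂ) = M) (hA : A.map (starRingEnd ℂ) = -A) :
    (gibbsState β M A).re = 0 := by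
  have h := gibbsState_map_starRingEnd β M A
  rw [hM, hA, map_neg] at h
  have h1 := congrArg Complex.re h
  rw [Complex.neg_re, Complex.conj_re] at h1
  linarith

/-! ## §5 Calculus plumbing for sector blocks and finite sums -/

/-- **Blocks of a differentiable family are differentiable**, with derivative the block of the derivative
(`toBlock` is linear, hence a continuous linear map in finite dimension). [folklore] -/
theorem hasDerivAt_toBlock (p q : m → Prop) [DecidablePred p] [DecidablePred q]
    {W : ℝ → Matrix m m ℂ} {W' : Matrix m m ℂ} {t₀ : ℝ} (hd : HasDerivAt W W' t₀) :
    HasDerivAt (fun t => (W t).toBlock p q) (W'.toBlock p q) t₀ := by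
  let Ll : Matrix m m ℂ →ₗ[ℂ] Matrix {a // p a} {a // q a} ℂ :=
    { toFun := fun M => M.toBlock p q, map_add' := fun _ _ => rfl, map_smul' := fun _ _ => rfl }
  let Lc : Matrix m m ℂ →L[ℝ] Matrix {a // p a} {a // q a} ℂ :=
    (LinearMap.toContinuousLinearMap Ll).restrictScalars ℝ
  have h := Lc.hasFDerivAt.comp_hasDerivAt t₀ hd
  exact h

/-- **Finite sums of scalar families times fixed matrices are differentiable**:
`d/dt Σ_i c_i(t) • M_i = Σ_i c_i′ • M_i`. [folklore] -/
theorem hasDerivAt_sum_smul {ι : Type*} (s : Finset ι) {c : ι → ℝ → ℂ} {c' : ι → ℂ}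
    (M : ι → Matrix m m ℂ) {t₀ : ℝ} (hc : ∀ i ∈ s, HasDerivAt (c i) (c' i) t₀) :
    HasDerivAt (fun t => ∑ i ∈ s, c i t • M i) (∑ i ∈ s, c' i • M i) t₀ := by
  have h := HasDerivAt.sum (u := s) (A := fun i t => c i t • M i) (A' := fun i => c' i • M i)
    (fun i hi => (hc i hi).smul_const (M i))
  refine h.congr_of_eventuallyEq (Eventually.of_forall fun t => ?_)
  simp only [Finset.sum_apply]

/-! ## §6 Block bookkeeping for sector-preserving operators -/

omit [Fintype m] [DecidableEq m] in
/-- If `N` has no matrix elements between the `p`-sector and its complement, its off-diagonal blocks vanish.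
[folklore] -/
theorem toBlock_not_eq_zero_of_offDiag (p : m → Prop) {N : Matrix m m ℂ}
    (hN : ∀ s t, p s → ¬ p t → N s t = 0 ∧ N t s = 0) :
    N.toBlock (fun a => ¬ p a) p = 0 ∧ N.toBlock p (fun a => ¬ p a) = 0 := by
  constructor
  · ext ⟨s, hs⟩ ⟨t, ht⟩
    exact (hN t s ht hs).2
  · ext ⟨s, hs⟩ ⟨t, ht⟩
    exact (hN s t hs ht).1

omit [DecidableEq m] in
/-- **Block multiplicativity against a sector-preserving operator (right factor)**:
`(A N)|_p = A|_p N|_p`. [folklore] -/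
theorem toBlock_mul_of_offDiag_right (p : m → Prop) [DecidablePred p] (A : Matrix m m ℂ)
    {N : Matrix m m ℂ} (hN : ∀ s t, p s → ¬ p t → N s t = 0 ∧ N t s = 0) :
    (A * N).toBlock p p = A.toBlock p p * N.toBlock p p := by
  rw [toBlock_mul_eq_add p p p A N, (toBlock_not_eq_zero_of_offDiag p hN).1, Matrix.mul_zero, add_zero]

omit [DecidableEq m] in
/-- **Block multiplicativity against a sector-preserving operator (left factor)**:
`(N A)|_p = N|_p A|_p`. [folklore] -/
theorem toBlock_mul_of_offDiag_left (p : m → Prop) [DecidablePred p] (A : Matrix m m ℂ)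
    {N : Matrix m m ℂ} (hN : ∀ s t, p s → ¬ p t → N s t = 0 ∧ N t s = 0) :
    (N * A).toBlock p p = N.toBlock p p * A.toBlock p p := by
  rw [toBlock_mul_eq_add p p p N A, (toBlock_not_eq_zero_of_offDiag p hN).2, Matrix.zero_mul, add_zero]

/-- **Stationarity in a sector**: for a sector-preserving `N`, the sector Gibbs expectation of the commutator
`H N − N H` vanishes, `⟨(HN − NH)|_p⟩_{β, H|_p} = 0` (block multiplicativity + the tree's
`Matrix.gibbsState_commutator_eq_zero`). [folklore] -/
theorem gibbsState_toBlock_commutator_eq_zero (p : m → Prop) [DecidablePred p] (β : ℝ)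
    (H : Matrix m m ℂ) {N : Matrix m m ℂ} (hN : ∀ s t, p s → ¬ p t → N s t = 0 ∧ N t s = 0) :
    gibbsState β (H.toBlock p p) ((H * N - N * H).toBlock p p) = 0 := by
  have hsub : (H * N - N * H).toBlock p p = (H * N).toBlock p p - (N * H).toBlock p p := rfl
  rw [hsub, toBlock_mul_of_offDiag_right p H hN, toBlock_mul_of_offDiag_left p H hN]
  exact Matrix.gibbsState_commutator_eq_zero β _ _


end Summit.Ventures.CertifiedManyBodySolver.Theorems.TcThermcert1.GaugeQbpFarSeam
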